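import Mathlib
import HarnessLib

/-!
# The fixed-pair lemma of the K2(p) lower-band line: consecutive returning changes keep the chart letters in one pair

[OURS · counted 0 · pure combinatorics]  Nothing here is a statement about resolution of singularities in dimension
≥ 4 / characteristic `p`, which is NOT proved.  Cell `res-dim4-pi`, K2(p) lane (res-dim4-p-12 g2 / res-dim4-p-5 g2,
idea-4 g3 cards I-4-6/7/8): the COMBINATORIAL HALF of the fixed-pair theorem of `…ResConeFixedPair` (p-5 g2), signature
posted by res-dim4-p-5 g2 (bus 2026-08-28T22:08:32Z) and proved here verbatim:

* `ResCone.letters_in_pair` — for a sequence of chart letters `j : ℕ → Fin 4` with a CHANGE at time `k₁`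
  (`j (k₁+1) ≠ j k₁`), if every two CONSECUTIVE changes `a < c` (change at `a`, `j` constant `= j (a+1)` on `(a, c]`,
  change at `c`) RETURN (`j (c+1) = j a`), then every letter from `k₁` on lies in the pair `{j k₁, j (k₁+1)}`.

Proof: induction on `k ≥ k₁ + 1` carrying the last change time `a ∈ [k₁, k)` with `j = j (a+1)` on `(a, k]` and
`{j a, j (a+1)} ⊆ {j k₁, j (k₁+1)}`; a change at `k` returns to `j a` by hypothesis.  Typed and proved by res-dim4-typ-1
(g2) on call.  Supports stmt-ResolutionOfSingularities-16155 (helper).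
bears_on: LADDER-RESOLUTION:D157-DOOR2 (res-dim4-pi · K2(p) lower band · fixed pair).
-/

set_option linter.dupNamespace false -- mandated namespace of this single-conjunct summit

namespace Summit.ResolutionOfSingularities.ResolutionOfSingularities.Theorems.PIDim4

namespace ResCone

/-- The induction invariant: a last change time `a ∈ [k₁, k)` after which the letter is constant up to `k`, with both
letters of that change in the pair `{j k₁, j (k₁+1)}`. [folklore] -/
theorem exists_last_change (j : ℕ → Fin 4) (k₁ : ℕ) (hchg : j (k₁ + 1) ≠ j k₁)
    (hret : ∀ a c : ℕ, k₁ ≤ a → a < c → j (a + 1) ≠ j a → (∀ τ, a < τ → τ ≤ c → j τ = j (a + 1)) →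
      j (c + 1) ≠ j c → j (c + 1) = j a)
    (k : ℕ) (hk : k₁ + 1 ≤ k) :
    ∃ a, k₁ ≤ a ∧ a < k ∧ j (a + 1) ≠ j a ∧ (∀ τ, a < τ → τ ≤ k → j τ = j (a + 1)) ∧
      (j a = j k₁ ∨ j a = j (k₁ + 1)) ∧ (j (a + 1) = j k₁ ∨ j (a + 1) = j (k₁ + 1)) := by
  induction k, hk using Nat.le_induction with
  | base =>
    refine ⟨k₁, le_rfl, Nat.lt_succ_self k₁, hchg, fun τ h1 h2 => ?_, Or.inl rfl, Or.inr rfl⟩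
    obtain rfl : τ = k₁ + 1 := le_antisymm h2 h1
    rfl
  | succ k hk ih =>
    obtain ⟨a, hk₁a, hak, hcha, hconst, hpa, hpa1⟩ := ih
    by_cases h : j (k + 1) = j k
    · -- no change at `k`: keep the same last change time
      refine ⟨a, hk₁a, Nat.lt_succ_of_lt hak, hcha, fun τ h1 h2 => ?_, hpa, hpa1⟩
      rcases Nat.lt_or_ge τ (k + 1) with hτ | hτ
      · exact hconst τ h1 (Nat.lt_succ_iff.mp hτ)
      · obtain rfl : τ = k + 1 := le_antisymm h2 hτ
        rw [h, hconst k hak le_rfl]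
    · -- a change at `k`: it returns to `j a`, and `k` becomes the last change time
      have hk' : j (k + 1) = j a := hret a k hk₁a hak hcha hconst h
      have hjk : j k = j (a + 1) := hconst k hak le_rfl
      refine ⟨k, by omega, Nat.lt_succ_self k, h, fun τ h1 h2 => ?_, ?_, ?_⟩
      · obtain rfl : τ = k + 1 := le_antisymm h2 h1
        rfl
      · rw [hjk]; exact hpa1
      · rw [hk']; exact hpa

/-- **THE FIXED PAIR** (res-dim4-p-5 g2's signature, verbatim): with a change at `k₁` and every two consecutive
changes returning, all letters from `k₁` on lie in `{j k₁, j (k₁ + 1)}`. [folklore] -/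
theorem letters_in_pair (j : ℕ → Fin 4) (k₁ : ℕ) (hchg : j (k₁ + 1) ≠ j k₁)
    (hret : ∀ a c : ℕ, k₁ ≤ a → a < c → j (a + 1) ≠ j a → (∀ τ, a < τ → τ ≤ c → j τ = j (a + 1)) →
      j (c + 1) ≠ j c → j (c + 1) = j a) :
    ∀ k, k₁ ≤ k → j k = j k₁ ∨ j k = j (k₁ + 1) := by
  intro k hk
  rcases Nat.lt_or_ge k (k₁ + 1) with hlt | hge
  · obtain rfl : k = k₁ := le_antisymm (Nat.lt_succ_iff.mp hlt) hk
    exact Or.inl rfl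
  · obtain ⟨a, -, hak, -, hconst, -, hpa1⟩ := exists_last_change j k₁ hchg hret k hge
    rw [hconst k hak le_rfl]
    exact hpa1

end ResCone

end Summit.ResolutionOfSingularities.ResolutionOfSingularities.Theorems.PIDim4
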